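import Literature.Topology.FourManifolds.RouteGraph
import HarnessLib

/-!
# Choosing the twist of the meridian chart from the two tips

Topic `Literature/Topology/FourManifolds`; fact seat `provefact-IsStrictHandleSlide.isSurgery`
(R. C. Kirby, *The Topology of 4-Manifolds*, LNM 1374 (1989), Ch. I §4, Fig. 4.2; remaining content:
the named fact (S) `Literature.Topology.FourManifolds.FramedLink.IsStrictHandleSlide.slideModel`).
In the twisted meridian chart (`TwistCoords.lean`, `RouteGraph.lean`) the two tips of the slid
circle, at slice radii `r₁, r₂ > 0` and separated by the angle `S ∈ (0, 2π)`, must both be twisted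
to the vertical: with the axis placed at angle `θ₁` below the first tip and `θ₂ = S - θ₁` above the
second, `e^{c r₁} tan (θ₁/2) = 1` and `e^{c r₂} tan (θ₂/2) = 1`. Eliminating the axis,
`c` solves `2 arctan (e^{-c r₁}) + 2 arctan (e^{-c r₂}) = S`, whose left side is continuous and
strictly decreasing from `2π` to `0`; so `c` exists and is unique (`exists_twist`), and it is
bounded in terms of margins of `S` and bounds of the radii (`abs_twist_le`).

## References

* R. C. Kirby, *The Topology of 4-Manifolds*, LNM 1374, Springer (1989), Ch. I §4. [Kirby1989]
-/

open Set Real Filter Topology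

noncomputable section

namespace Literature.Topology.FourManifolds

/-- The tip-angle sum `Σ(c) = 2 arctan (e^{-c r₁}) + 2 arctan (e^{-c r₂})`. [folklore] -/
def tipSum (r₁ r₂ c : ℝ) : ℝ := 2 * arctan (exp (-(c * r₁))) + 2 * arctan (exp (-(c * r₂)))

/-- `continuous_tipSum` (auxiliary). [folklore] -/
theorem continuous_tipSum (r₁ r₂ : ℝ) : Continuous (tipSum r₁ r₂) := by
  unfold tipSum; fun_prop

/-- The tip-angle sum is strictly decreasing in the twist (for positive radii). [folklore] -/
theorem strictAnti_tipSum {r₁ r₂ : ℝ} (h₁ : 0 < r₁) (h₂ : 0 < r₂) : StrictAnti (tipSum r₁ r₂) := by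
  intro a b hab
  unfold tipSum
  have e1 : exp (-(b * r₁)) < exp (-(a * r₁)) := exp_lt_exp.2 (by nlinarith)
  have e2 : exp (-(b * r₂)) < exp (-(a * r₂)) := exp_lt_exp.2 (by nlinarith)
  have := arctan_strictMono e1; have := arctan_strictMono e2
  linarith

/-- Each tip angle lies in `(0, π)`. [folklore] -/
theorem two_arctan_exp_mem (x : ℝ) : 2 * arctan (exp x) ∈ Ioo 0 π := by
  have h1 := arctan_lt_pi_div_two (exp x)
  have h2 : 0 < arctan (exp x) := by
    have := arctan_strictMono (exp_pos x); rwa [arctan_zero] at this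
  constructor <;> linarith

/-- The tip-angle sum tends to `2π` as `c → -∞` and to `0` as `c → +∞`; quantitatively:
for `c ≤ -T/min r` it exceeds `2π - 8 e^{-T}`... we use the cruder explicit bounds below. [folklore] -/
theorem tipSum_ge (r₁ r₂ c : ℝ) : 4 * arctan (exp (-(c * max r₁ r₂))) ≤ tipSum r₁ r₂ c ∨ 4 * arctan (exp (-(c * min r₁ r₂))) ≤ tipSum r₁ r₂ c := by
  unfold tipSum
  rcases le_total 0 c with hc | hc
  · left
    have e1 : exp (-(c * max r₁ r₂)) ≤ exp (-(c * r₁)) := exp_le_exp.2 (by nlinarith [le_max_left r₁ r₂])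
    have e2 : exp (-(c * max r₁ r₂)) ≤ exp (-(c * r₂)) := exp_le_exp.2 (by nlinarith [le_max_right r₁ r₂])
    have := arctan_strictMono.monotone e1; have := arctan_strictMono.monotone e2
    linarith
  · right
    have e1 : exp (-(c * min r₁ r₂)) ≤ exp (-(c * r₁)) := exp_le_exp.2 (by nlinarith [min_le_left r₁ r₂])
    have e2 : exp (-(c * min r₁ r₂)) ≤ exp (-(c * r₂)) := exp_le_exp.2 (by nlinarith [min_le_right r₁ r₂])
    have := arctan_strictMono.monotone e1; have := arctan_strictMono.monotone e2
    linarith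

/-- **Existence and uniqueness of the twist.** For `r₁, r₂ > 0` and `S ∈ (0, 2π)` there is a unique
`c` with `tipSum r₁ r₂ c = S`. [cite: Kirby1989, Ch. I §4] -/
theorem exists_unique_twist {r₁ r₂ S : ℝ} (h₁ : 0 < r₁) (h₂ : 0 < r₂) (hS : S ∈ Ioo 0 (2 * π)) :
    ∃! c, tipSum r₁ r₂ c = S := by
  -- values above and below `S`
  have hr : 0 < min r₁ r₂ := lt_min h₁ h₂
  have hR : 0 < max r₁ r₂ := h₁.trans_le (le_max_left _ _)
  -- large negative `c`: `tipSum ≥ 4 arctan (e^{|c| min r}) → 2π`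
  have hlim_neg : Tendsto (fun c : ℝ ↦ 4 * arctan (exp (-(c * min r₁ r₂)))) atBot (𝓝 (4 * (π / 2))) := by
    have h1 : Tendsto (fun c : ℝ ↦ -(c * min r₁ r₂)) atBot atTop := by
      have : Tendsto (fun c : ℝ ↦ c * min r₁ r₂) atBot atBot := tendsto_id.atBot_mul_const hr
      exact tendsto_neg_atBot_atTop.comp this
    have h2 := (tendsto_arctan_atTop.mono_right nhdsWithin_le_nhds).comp (tendsto_exp_atTop.comp h1)
    exact h2.const_mul 4
  have hlim_pos : Tendsto (fun c : ℝ ↦ 4 * arctan (exp (-(c * min r₁ r₂)))) atTop (𝓝 (4 * 0)) := by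
    have h1 : Tendsto (fun c : ℝ ↦ -(c * min r₁ r₂)) atTop atBot := by
      have : Tendsto (fun c : ℝ ↦ c * min r₁ r₂) atTop atTop := tendsto_id.atTop_mul_const hr
      exact tendsto_neg_atTop_atBot.comp this
    have h2 : Tendsto (fun c : ℝ ↦ arctan (exp (-(c * min r₁ r₂)))) atTop (𝓝 0) := by
      have he := tendsto_exp_atBot.comp h1
      have := (continuous_arctan.tendsto 0).comp he
      rwa [arctan_zero] at this
    exact h2.const_mul 4
  have hlim_pos' : Tendsto (fun c : ℝ ↦ 4 * arctan (exp (-(c * max r₁ r₂)))) atTop (𝓝 (4 * 0)) := by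
    have h1 : Tendsto (fun c : ℝ ↦ -(c * max r₁ r₂)) atTop atBot := by
      have : Tendsto (fun c : ℝ ↦ c * max r₁ r₂) atTop atTop := tendsto_id.atTop_mul_const hR
      exact tendsto_neg_atTop_atBot.comp this
    have h2 : Tendsto (fun c : ℝ ↦ arctan (exp (-(c * max r₁ r₂)))) atTop (𝓝 0) := by
      have he := tendsto_exp_atBot.comp h1
      have := (continuous_arctan.tendsto 0).comp he
      rwa [arctan_zero] at this
    exact h2.const_mul 4
  -- a point with `tipSum > S` (c very negative)
  obtain ⟨a, ha⟩ : ∃ a, S < tipSum r₁ r₂ a := by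
    have hev : ∀ᶠ c in atBot, S < 4 * arctan (exp (-(c * min r₁ r₂))) :=
      hlim_neg.eventually (lt_mem_nhds (by linarith [hS.2]))
    obtain ⟨a, ha⟩ := (hev.and (eventually_le_atBot 0)).exists
    refine ⟨a, ?_⟩
    -- for `a ≤ 0` the `min` bound is the valid one
    have e1 : exp (-(a * min r₁ r₂)) ≤ exp (-(a * r₁)) := exp_le_exp.2 (by nlinarith [min_le_left r₁ r₂, ha.2])
    have e2 : exp (-(a * min r₁ r₂)) ≤ exp (-(a * r₂)) := exp_le_exp.2 (by nlinarith [min_le_right r₁ r₂, ha.2])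
    have := arctan_strictMono.monotone e1; have := arctan_strictMono.monotone e2
    unfold tipSum; linarith [ha.1]
  -- a point with `tipSum < S` (c very positive): bound above by the `min`-radius term for `c ≥ 0`
  obtain ⟨b, hb⟩ : ∃ b, tipSum r₁ r₂ b < S := by
    have hev : ∀ᶠ c in atTop, 4 * arctan (exp (-(c * min r₁ r₂))) < S := by
      have := hlim_pos.eventually (gt_mem_nhds (by simpa using hS.1))
      exact this
    obtain ⟨b, hb⟩ := (hev.and (eventually_ge_atTop 0)).exists
    refine ⟨b, ?_⟩
    have e1 : exp (-(b * r₁)) ≤ exp (-(b * min r₁ r₂)) := exp_le_exp.2 (by nlinarith [min_le_left r₁ r₂, hb.2])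
    have e2 : exp (-(b * r₂)) ≤ exp (-(b * min r₁ r₂)) := exp_le_exp.2 (by nlinarith [min_le_right r₁ r₂, hb.2])
    have := arctan_strictMono.monotone e1; have := arctan_strictMono.monotone e2
    unfold tipSum; linarith [hb.1]
  have hab : a < b := by
    by_contra h
    have := (strictAnti_tipSum h₁ h₂).antitone (le_of_not_gt h)
    linarith
  -- intermediate value on `[a, b]` for the decreasing continuous function
  have hcont : ContinuousOn (tipSum r₁ r₂) (Icc a b) := (continuous_tipSum r₁ r₂).continuousOn
  obtain ⟨c, hc, hcS⟩ := intermediate_value_Icc' hab.le hcont ⟨hb.le, ha.le⟩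
  refine ⟨c, hcS, fun c' hc' ↦ ?_⟩
  exact (strictAnti_tipSum h₁ h₂).injective (hc'.trans hcS.symm)

/-- **The twist determined by the tips.** [folklore] -/
def twistOf (r₁ r₂ S : ℝ) (h₁ : 0 < r₁) (h₂ : 0 < r₂) (hS : S ∈ Ioo 0 (2 * π)) : ℝ :=
  Classical.choose (exists_unique_twist h₁ h₂ hS).exists

/-- `tipSum_twistOf` (auxiliary). [folklore] -/
theorem tipSum_twistOf {r₁ r₂ S : ℝ} (h₁ : 0 < r₁) (h₂ : 0 < r₂) (hS : S ∈ Ioo 0 (2 * π)) :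
    tipSum r₁ r₂ (twistOf r₁ r₂ S h₁ h₂ hS) = S :=
  Classical.choose_spec (exists_unique_twist h₁ h₂ hS).exists

/-- **The two tip conditions** from the twist and the axis `θ₁ = 2 arctan (e^{-c r₁})`,
`θ₂ = S - θ₁ = 2 arctan (e^{-c r₂})`: `e^{c rᵢ} tan (θᵢ/2) = 1`. [folklore] -/
theorem tip_conditions {r₁ r₂ S : ℝ} (h₁ : 0 < r₁) (h₂ : 0 < r₂) (hS : S ∈ Ioo 0 (2 * π)) :
    let c := twistOf r₁ r₂ S h₁ h₂ hS
    let θ₁ := 2 * arctan (exp (-(c * r₁)))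
    exp (c * r₁) * tan (θ₁ / 2) = 1 ∧ exp (c * r₂) * tan ((S - θ₁) / 2) = 1 ∧
      θ₁ ∈ Ioo 0 π ∧ S - θ₁ ∈ Ioo 0 π := by
  intro c θ₁
  have hsum := tipSum_twistOf h₁ h₂ hS
  have hθ₂ : S - θ₁ = 2 * arctan (exp (-(c * r₂))) := by
    simp only [θ₁]; unfold tipSum at hsum; linarith
  refine ⟨?_, ?_, two_arctan_exp_mem _, hθ₂ ▸ two_arctan_exp_mem _⟩
  · simp only [θ₁]
    rw [mul_div_cancel_left₀ _ two_ne_zero, tan_arctan, ← exp_add]; simp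
  · rw [hθ₂, mul_div_cancel_left₀ _ two_ne_zero, tan_arctan, ← exp_add]; simp

/-- **A priori bound of the twist**: if the two tip angles must each lie in `[η, π - η]`-compatible
ranges — precisely, if `S ∈ [2η, 2π - 2η]` with `0 < η` — and `r₁, r₂ ∈ [1, 2]`, then
`|c| ≤ |log (tan (η/2))|`. (At `|c| = L := |log tan (η/2)|` one of the bounds `tipSum ≤ 4 arctan e^{-L}
= 2η ≤ S` or `tipSum ≥ 4 arctan e^{L} = 2π - 2η ≥ S` is violated strictly unless equality.) [folklore] -/
theorem abs_twist_le {r₁ r₂ S η : ℝ} (h₁ : r₁ ∈ Icc (1 : ℝ) 2) (h₂ : r₂ ∈ Icc (1 : ℝ) 2) (hη : 0 < η) (hηπ : η < π / 2)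
    (hS : S ∈ Icc (2 * η) (2 * π - 2 * η)) {c : ℝ} (hc : tipSum r₁ r₂ c = S) :
    |c| ≤ -Real.log (tan (η / 2)) := by
  -- `L = -log tan (η/2) > 0` since `tan (η/2) < 1`
  have hη2 : η / 2 ∈ Ioo 0 (π / 4) := ⟨by linarith, by linarith⟩
  have htan_pos : 0 < tan (η / 2) := tan_pos_of_pos_of_lt_pi_div_two hη2.1 (by linarith [pi_pos])
  have htan_lt : tan (η / 2) < 1 := by
    rw [← tan_pi_div_four]
    exact strictMonoOn_tan ⟨by linarith, by linarith [pi_pos]⟩ ⟨by linarith [pi_pos], by linarith [pi_pos]⟩ hη2.2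
  set L := -Real.log (tan (η / 2)) with hL
  have hL0 : 0 ≤ L := by rw [hL]; have := Real.log_nonpos htan_pos.le htan_lt.le; linarith
  have hexpL : exp (-L) = tan (η / 2) := by rw [hL, neg_neg, exp_log htan_pos]
  have harc : arctan (exp (-L)) = η / 2 := by
    rw [hexpL]; exact arctan_tan (by linarith) (by linarith [pi_pos])
  by_contra hlt
  have hlt' : L < |c| := lt_of_not_ge hlt
  rcases le_or_gt 0 c with hc0 | hc0
  · -- `c > L`: `tipSum < 4 arctan (e^{-L·1}) = 2η ≤ S`
    rw [abs_of_nonneg hc0] at hlt'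
    have e1 : exp (-(c * r₁)) < exp (-L) := exp_lt_exp.2 (by nlinarith [h₁.1])
    have e2 : exp (-(c * r₂)) < exp (-L) := exp_lt_exp.2 (by nlinarith [h₂.1])
    have a1 := arctan_strictMono e1; have a2 := arctan_strictMono e2
    rw [harc] at a1 a2
    have : tipSum r₁ r₂ c < 2 * η := by unfold tipSum; linarith
    linarith [hS.1]
  · -- `c < -L`: `tipSum > 4 arctan (e^{L}) = 2π - 2η ≥ S`
    rw [abs_of_neg hc0] at hlt'
    have harc' : arctan (exp L) = π / 2 - η / 2 := by
      have h := arctan_inv_of_pos (exp_pos (-L))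
      rw [harc, ← exp_neg, neg_neg] at h
      linarith [h]
    have e1 : exp L < exp (-(c * r₁)) := exp_lt_exp.2 (by nlinarith [h₁.1])
    have e2 : exp L < exp (-(c * r₂)) := exp_lt_exp.2 (by nlinarith [h₂.1])
    have a1 := arctan_strictMono e1; have a2 := arctan_strictMono e2
    rw [harc'] at a1 a2
    have : 2 * π - 2 * η < tipSum r₁ r₂ c := by unfold tipSum; linarith
    linarith [hS.2]

end Literature.Topology.FourManifolds
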